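import Summits.SmoothPoincare4.SmoothPoincare4.Theorems.NilpotentShadowsStandard.Negative.LoadBearing
import Summits.SmoothPoincare4.SmoothPoincare4.Theorems.AgkCor6Sufficiency.Negative.AnyGroupFalse

/-!
# `NilpotentShadowsStandard` — negative-side support II: the trivial group is load-bearing,
# UNCONDITIONALLY (crux `stmt-SmoothPoincare4-14594`, route `CongruenceShadows`)

`LoadBearing.lean` proved the any-group form of the crux false modulo the existence of a `(3,1)` group
trisection of a non-trivial cyclic group.  The tree already contains one: `zKernels`, the `(3,1)`
trisection of `S¹ × S³ # ℂP² # ℂP²` (`Theorems/AgkCor6Sufficiency/Negative/AnyGroupFalse.lean`,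
`zKernels_isGroupTrisection`), a group trisection of its triple quotient `≅ ℤ`, all of whose kernels die
under the `b₀`-indicator `S₃ ↠ ℤ/2` (`zKernels_le_ker_toCommGroup_zDetect`).  Hence
`nilpotentShadowsStandardAnyGroup_false`: with the trivial group replaced by an arbitrary group the
nilpotent-shadow statement fails already at `m = 0`, `c = 0` — the abelian shadow of a `(3,1)` trisection
sees `H₁` of the trisected 4-manifold.  So any proof of the crux must use `π₁ = 1` (the `PUnit` in
`IsGroupTrisection (3+3m) (m+1) PUnit K`), and already at the abelian level.
-/

noncomputable section

-- the prescribed namespace `Summit.<P>.<Sub>.…` duplicates `SmoothPoincare4` (P = Sub)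
set_option linter.dupNamespace false

namespace Summit.SmoothPoincare4.SmoothPoincare4.Theorems.NilpotentShadowsStandard.Negative

open Literature.Topology.FourManifolds Subgroup
open Summit.SmoothPoincare4.SmoothPoincare4.Theses.CongruenceShadows
open Summit.SmoothPoincare4.SmoothPoincare4.Theorems.AgkCor6Sufficiency.Negative

/-- THE TRIVIAL GROUP IS LOAD-BEARING (unconditional form): the crux with `PUnit` replaced by an
arbitrary group is false, witnessed at `m = 0`, `c = 0` by the `(3,1)` trisection `zKernels` of
`S¹ × S³ # ℂP² # ℂP²` (group `ℤ`): every `Kᵢ·γ₂` lies in the kernel of the `b₀`-indicator `S₃ ↠ ℤ/2`,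
whereas the standard kernels generate `S₃`, so no automorphism matches the abelian shadows. [folklore] -/
theorem nilpotentShadowsStandardAnyGroup_false :
    ¬ ∀ (m : ℕ) (G : Type) [Group G] (K : TrisectionKernels (3 + 3 * m)),
        IsGroupTrisection (3 + 3 * m) (m + 1) G K → ∀ c : ℕ,
          ∃ ψ : SurfaceGroup (3 + 3 * m) ≃* SurfaceGroup (3 + 3 * m), ∀ i : Fin 3,
            (s4Kernels.stabilizeIter m i ⊔
                (⊤ : Subgroup (SurfaceGroup (3 + 3 * m))).lowerCentralSeries (c + 1)).map ψ.toMonoidHom =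
              K i ⊔ (⊤ : Subgroup (SurfaceGroup (3 + 3 * m))).lowerCentralSeries (c + 1) := by
  intro h
  obtain ⟨ψ, hψ⟩ := h 0 zKernels.tripleQuotient zKernels zKernels_isGroupTrisection 0
  set χ : SurfaceGroup 3 →* Multiplicative (ZMod 2) := SurfaceGroup.toCommGroup zDetect with hχ
  have hγ : (⊤ : Subgroup (SurfaceGroup 3)).lowerCentralSeries 1 ≤ χ.ker := by
    rw [Subgroup.top_lowerCentralSeries_one]
    exact Abelianization.commutator_subset_ker _
  have hall : ∀ i, zKernels i ⊔ (⊤ : Subgroup (SurfaceGroup 3)).lowerCentralSeries 1 ≤ χ.ker :=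
    fun i => sup_le (zKernels_le_ker_toCommGroup_zDetect i) hγ
  have htop : (⊤ : Subgroup (SurfaceGroup 3)) ≤ χ.ker := by
    have h3 : (s4Kernels 0 ⊔ (⊤ : Subgroup (SurfaceGroup 3)).lowerCentralSeries 1) ⊔
        (s4Kernels 1 ⊔ (⊤ : Subgroup (SurfaceGroup 3)).lowerCentralSeries 1) ⊔
        (s4Kernels 2 ⊔ (⊤ : Subgroup (SurfaceGroup 3)).lowerCentralSeries 1) = ⊤ := by
      rw [eq_top_iff, ← s4Kernels_sup_eq_top]
      exact sup_le (sup_le (le_sup_left.trans (le_sup_left.trans le_sup_left))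
        (le_sup_left.trans (le_sup_right.trans le_sup_left))) (le_sup_left.trans le_sup_right)
    have := congrArg (Subgroup.map ψ.toMonoidHom) h3
    rw [map_top_equiv, Subgroup.map_sup, Subgroup.map_sup] at this
    rw [← this]
    exact sup_le (sup_le ((hψ 0).le.trans (hall 0)) ((hψ 1).le.trans (hall 1)))
      ((hψ 2).le.trans (hall 2))
  have hb : χ (zb 0) = 1 := (MonoidHom.mem_ker).1 (htop (Subgroup.mem_top _))
  rw [hχ, SurfaceGroup.toCommGroup_of] at hb
  revert hb
  decide

end Summit.SmoothPoincare4.SmoothPoincare4.Theorems.NilpotentShadowsStandard.Negative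

end
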